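import Summits.ResolutionOfSingularities.ResolutionOfSingularities.Theorems.SharpStrataSepExcModelsKolchinPhase
import Literature.AlgebraicGeometry.Resolution.LipmanProcedure
import Literature.AlgebraicGeometry.Resolution.AlterationsNormalizationReduction
import HarnessLib

/-!
# Route SharpStrata — crux `SepExcModels` (stmt-ResolutionOfSingularities-16828): the Kolchin phase
# terminates in dimension ≤ 2 (calibration of the open stub `stub_kolchinTerminates`)

Line `registered`, lead seat 0, cycle 1. The one open stub of the line asks for `Acc (KolchinRel k) V`
for every variety `V` over a perfect field (termination of "blow up the reduced sharp strata,
normalise, repeat"; Benito–Piltant–Reguera 2022, Question 6.6 for the canonical process). This file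
proves it for `dim V ≤ 2`, unconditionally and over any field:

* `sharpLocus_eq_empty_of_normal_of_dim_le_two` — a NORMAL integral scheme locally of finite type over
  a field with `dim ≤ 2` has no sharp point: every point is regular or closed (singular points of a
  normal surface are closed points, `isClosed_singleton_of_not_mem_regularLocus` — normal ⇒ (R₁)), and
  these are the first two disjuncts of `SepExcAt`;
* `acc_kolchinRel_of_topologicalKrullDim_le_two` — hence `Acc (KolchinRel k) V` with depth ≤ 1: a
  Kolchin successor `V⁺` of `V` is (isomorphic to) the normalisation of a blow-up of `V`, so it is normal
  (`isIntegrallyClosed_stalk_normalization`) of the same dimension (blow-ups along non-zero ideals and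
  normalisations are alterations, `IsAlteration.topologicalKrullDim_eq`), so it has no sharp point and
  therefore no Kolchin successor.

Sources: BPR 2022, Question 6.6 [BenitoPiltantReguera2022]; Q. Liu, *Algebraic Geometry and Arithmetic
Curves*, §8.3.4 (normal surfaces: singular points are closed) [Liu2002]. The first dimension in which
the stub has content is 3 (sharp points are non-closed of codimension ≥ 2 on normal varieties).
-/

noncomputable section

-- single-problem summit: the doubled namespace component `ResolutionOfSingularities` is forced
set_option linter.dupNamespace false

open CategoryTheory AlgebraicGeometry TopologicalSpace Topology
open Literature.AlgebraicGeometry.Resolution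

namespace Summit.ResolutionOfSingularities.ResolutionOfSingularities.Theorems.SepExcModels

/-- **A normal surface has no sharp point**: on an integral locally Noetherian scheme with integrally
closed local rings and `dim ≤ 2`, every point is regular or closed (`isClosed_singleton_of_not_mem_
regularLocus`), so it is separably exceptional at every point and `sharpLocus = ∅`. [folklore] -/
theorem sharpLocus_eq_empty_of_normal_of_dim_le_two (Y : Scheme.{0}) [IsIntegral Y]
    [IsLocallyNoetherian Y] (hN : ∀ y : Y, IsIntegrallyClosed (Y.presheaf.stalk y))
    (hdim : topologicalKrullDim Y ≤ 2) : sharpLocus Y = ∅ := by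
  ext ζ
  simp only [Set.mem_empty_iff_false, iff_false]
  intro hζ
  apply hζ
  by_cases hreg : ζ ∈ Scheme.regularLocus Y
  · exact Or.inl hreg
  · exact Or.inr (Or.inl (isClosed_singleton_of_not_mem_regularLocus hN hdim hreg))

/-- A Kolchin successor of a variety of dimension `≤ 2` is normal and of dimension `≤ 2`: it is
isomorphic to the normalisation of a blow-up along the (non-zero) ideal of the sharp centre.
[folklore] -/
theorem normal_and_dim_le_two_of_kolchinRel (k : Type) [Field k] {V' V : KVariety k}
    (h : KolchinRel k V' V) (hV : topologicalKrullDim V.X ≤ 2) :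
    (∀ y : V'.X, IsIntegrallyClosed (V'.X.presheaf.stalk y)) ∧ topologicalKrullDim V'.X ≤ 2 := by
  obtain ⟨-, π, -, hS, B, β, hB, e, hblow, -⟩ := h
  haveI := hB
  haveI : IsLocallyNoetherian V.X := LocallyOfFiniteType.isLocallyNoetherian V.hom
  have hJ : Scheme.IdealSheafData.vanishingIdeal ⟨sharpCentre V.X, hS⟩ ≠ ⊥ :=
    NormalizedBlowup.vanishingIdeal_ne_bot ⟨sharpCentre V.X, hS⟩ (sharpCentre_ne_univ V.X)
  haveI : IsProper β := hblow.isProper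
  constructor
  · intro y
    exact IsIntegrallyClosed.of_equiv
      (asIso (e.hom.stalkMap y)).commRingCatIsoToRingEquiv
      (h := isIntegrallyClosed_stalk_normalization B (e.hom y))
  · have h1 : topologicalKrullDim V'.X = topologicalKrullDim (normalization B) :=
      IsHomeomorph.topologicalKrullDim_eq _ (Scheme.homeoOfIso e).isHomeomorph
    have h2 : topologicalKrullDim (normalization B) = topologicalKrullDim B :=
      (isAlteration_normalizationι B NoetherFiniteIntegralClosure_holds (β ≫ V.hom))
        |>.topologicalKrullDim_eq (β ≫ V.hom)
    have h3 : topologicalKrullDim B = topologicalKrullDim V.X :=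
      (isAlteration_of_isBlowup hblow hJ).topologicalKrullDim_eq V.hom
    rw [h1, h2, h3]
    exact hV

/-- **The Kolchin phase terminates in dimension ≤ 2** (calibration of `stub_kolchinTerminates`,
registered headline `acc_kolchinRel_of_topologicalKrullDim_le_two`): every `V : KVariety k` with
`dim V ≤ 2` is accessible for `KolchinRel k`, with depth ≤ 1 — a successor is a normal surface
(or curve, or point), which has no sharp point, hence no successor. Over ANY field (perfectness is
not used). [cite: BenitoPiltantReguera2022, Question 6.6] -/
theorem acc_kolchinRel_of_topologicalKrullDim_le_two (k : Type) [Field k] (V : KVariety k)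
    (hV : topologicalKrullDim V.X ≤ 2) : Acc (KolchinRel k) V := by
  refine Acc.intro V fun V' hV' => ?_
  obtain ⟨hN, hdim⟩ := normal_and_dim_le_two_of_kolchinRel k hV' hV
  refine Acc.intro V' fun V'' hV'' => ?_
  obtain ⟨hne, -⟩ := hV''
  haveI : IsLocallyNoetherian V'.X := LocallyOfFiniteType.isLocallyNoetherian V'.hom
  rw [sharpLocus_eq_empty_of_normal_of_dim_le_two V'.X hN hdim] at hne
  exact absurd hne Set.not_nonempty_empty

end Summit.ResolutionOfSingularities.ResolutionOfSingularities.Theorems.SepExcModels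

end
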